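import Mathlib
import HarnessLib
import Summits.HubbardSuperconductivity.HubbardSuperconductivity.Theorems.KLProgrammeKLRegimeWickCrossContractionGramValueB

/-!
# Route `KLProgramme` — ENGINE child gen 6 (stmt-HubbardSuperconductivity-20236 `KLRegimeEngineV16`), `stub_engine_step_values` (E2-v10):
# the value form with a Gram tail KEYED AS THE TRANSPORT USES IT — lines pulled back by the FAT family `Ft`, vertices the sector preimages for the
# THIN family `F` (cell gate-hubbard-kl, seat p5 g5; companion of `…GramValue` / `…GramValueB`)

The push-forward `map (toLin' S(Ft)) (sectorPreimage β F G) = G` (`map_sectorSub_sectorPreimage`, `Ft·F = F`; r2d-p2's plateau form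
`map_sectorSub_sectorPreimage_eq_map_mulLeft`) and the transport `dblFold_crossContract_map` (p512067) turn the physical `k`-line term into the
sector-field term whose LINES are `S(Ft)ᵀ·C_i·S(Ft)` (fat family: overlap count `ρ₀`, row sums `α`, entries `δ_i`, Gram half-norms `κ_i` all w.r.t.
`Ft`) and whose VERTICES are `sectorPreimage β F Ga`, `sectorPreimage β F Gb` (thin family: the level norms `‖·‖_{F, prescribedTuples …}` of
`KernelNormsV4` / `KernelNormsLevels`).  `…GramValue.norm_kernel_crossContract_value_sectorPreimage_le_gram` keys both to one family; here the two-family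
statements the (E2-v10) prover instantiates directly (same proofs: `…_value_pullback_le_gram(_of_b)` for `Ft` + the `F`-level lemmas):

* **`norm_kernel_crossContract_value_sectorPreimage_le_gram₂`** — `m₀ + 1 ≥ 1` output legs from `a`: `Ga` at `F`-level `m₀ + 1`, `Gb` at `F`-level `e' + 1 + m₁`;
* **`norm_kernel_crossContract_value_sectorPreimage_le_gram₂_of_b`** — every output leg from `b` allowed: `Ga` at `F`-level `e' + 1 + m₀`, `Gb` at
  `F`-level `m₁ + 1`.

Pure bookkeeping; no definitions, no named facts.
-/

noncomputable section

namespace Summit.HubbardSuperconductivity.HubbardSuperconductivity.Theorems.KLRegimeWick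

set_option linter.dupNamespace false -- summit = problem name (single-conjunct summit), D-0017

open Literature.MathematicalPhysics.QuantumLattice Literature.Probability.LatticeModels GrassmannAlgebra Finset Matrix
open Summit.HubbardSuperconductivity.HubbardSuperconductivity.Theorems.KLRegimeSplit

section TwoFamilies

variable {L M N : ℕ} [NeZero L]

/-- **Value form with a Gram tail, lines via `Ft`, vertices the `F`-sector preimages** (`m₀ + 1` output legs from `a`):
`‖kernel ((Δ_×(S(Ft)ᵀC_{k−1}S(Ft))∘⋯)((sectorPreimage β F Ga)⁰·(sectorPreimage β F Gb)¹)) m (Z,s)‖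
 ≤ ((k+(m₀+1))!(k+m₁)!/(m!·(k−e'−1)!))·(Σ_iκ_i²)^{k−e'−1}·(α·∏_{i<e'}(δ_i·4ρ₀)·(ε Na)·(ε Nb))`, `Na = ‖Ga‖_F` at level `m₀ + 1`, `Nb = ‖Gb‖_F` at level
`e' + 1 + m₁`. [cite: BenfattoGiulianiMastropietro2006, §2.8 (2.80)] -/
theorem norm_kernel_crossContract_value_sectorPreimage_le_gram₂ {k e' m m₀ m₁ : ℕ} (he : e' + 1 ≤ k) {β : ℝ} (hβ : 0 ≤ β)
    (F Ft : Fin N → FreqMomentum L M → ℂ)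
    {ρ₀ : ℕ} (hρ₀ : ∀ ω : Fin N, ((univ : Finset (Fin N)).filter fun ω' => ∃ q, Ft ω q * Ft ω' q ≠ 0).card ≤ ρ₀)
    (sym : Fin k → FreqMomentum L M × Fin 2 → ℂ) (κ : Fin k → ℝ)
    (hκF : ∀ (i : Fin k) (Y : SpaceTimeIdx L M × SectorLeg N), Y.2.2 = 0 → ‖sectorGramF L M β Ft (sym i) Y‖ ≤ κ i)
    (hκG : ∀ (i : Fin k) (Y : SpaceTimeIdx L M × SectorLeg N), Y.2.2 = 1 → ‖sectorGramG L M β Ft (sym i) Y‖ ≤ κ i)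
    (Ga Gb : HubbardGrassmann L M) (s : Fin m → Fin 2)
    (hm₀ : (univ.filter fun i => s i = 0).card = m₀ + 1) (hm₁ : (univ.filter fun i => s i = 1).card = m₁)
    (Z : Fin m → SpaceTimeIdx L M × SectorLeg N) {α : ℝ} (hα : 0 ≤ α)
    (hrow : ∀ X, ∑ Y, ‖((sectorSubMatrix L M β Ft).transpose * normalCovariance L M (sym (Fin.castLE he 0)) * sectorSubMatrix L M β Ft) X Y‖ ≤ α)
    (hcol : ∀ Y, ∑ X, ‖((sectorSubMatrix L M β Ft).transpose * normalCovariance L M (sym (Fin.castLE he 0)) * sectorSubMatrix L M β Ft) X Y‖ ≤ α)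
    (δ : Fin e' → ℝ) (hδ : ∀ i, 0 ≤ δ i)
    (hent : ∀ (i : Fin e') X Y,
      ‖((sectorSubMatrix L M β Ft).transpose * normalCovariance L M (sym (Fin.castLE he i.succ)) * sectorSubMatrix L M β Ft) X Y‖ ≤ δ i)
    {Na Nb : ℝ} (hNb0 : 0 ≤ Nb)
    (hNa : ∀ σ₀ : Fin (m₀ + 1) → SectorLeg N, hubbardSectorKernelNorm L M β F (prescribedTuples univ
      (Fin.append (fun _ : Fin k => (none : Option (SectorLeg N))) (fun j => some (σ₀ j)))) Ga ≤ Na)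
    (hNb : ∀ (ω₀ : SectorLeg N) (τ' : Fin e' → SectorLeg N) (ω₁ : Fin m₁ → SectorLeg N),
      hubbardSectorKernelNorm L M β F (prescribedTuples univ
        (Fin.append (fun i : Fin k => if h : (i : ℕ) < e' + 1 then some ((Fin.cons ω₀ τ' : Fin (e' + 1) → SectorLeg N) ⟨i, h⟩) else none)
          (fun j => some (ω₁ j)))) Gb ≤ Nb) :
    ‖kernel ℂ (((List.ofFn fun i => grassmannLaplacian ℂ (crossCov ℂ
        ((sectorSubMatrix L M β Ft).transpose * normalCovariance L M (sym i) * sectorSubMatrix L M β Ft))).reverse).prod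
        (dblCopy ℂ 0 (sectorPreimage β F Ga) * dblCopy ℂ 1 (sectorPreimage β F Gb))) m (fun i => (Z i, s i))‖ ≤
      (((k + (m₀ + 1)).factorial * (k + m₁).factorial : ℝ) / (m.factorial * (k - (e' + 1)).factorial)) *
        (∑ i, κ i ^ 2) ^ (k - (e' + 1)) *
        (α * (∏ i, δ i * ((4 * ρ₀ : ℕ) : ℝ)) * (imagTimeWeight β M * Na) * (imagTimeWeight β M * Nb)) :=
  norm_kernel_crossContract_value_pullback_le_gram he β Ft hρ₀ sym κ hκF hκG (sectorPreimage β F Ga) (sectorPreimage β F Gb) s hm₀ hm₁ Z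
    hα hrow hcol δ hδ hent (mul_nonneg (imagTimeWeight_nonneg hβ M) hNb0)
    (fun X₀ => (sum_fixed_norm_kernel_sectorPreimage_le hβ F Ga X₀).trans
      (mul_le_mul_of_nonneg_left (hNa _) (imagTimeWeight_nonneg hβ M)))
    fun Y₀ τ' Y₁ => (sum_sum_filter_castLE_norm_kernel_sectorPreimage_le hβ F Gb he Y₀ τ' Y₁).trans
      (mul_le_mul_of_nonneg_left (hNb _ _ _) (imagTimeWeight_nonneg hβ M))

/-- **The same, roles exchanged** (every output leg may come from `b`: `m₁ + 1` legs of `b`, `m₀ ≥ 0` legs of `a`): `Ga` at `F`-level `e' + 1 + m₀`,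
`Gb` at `F`-level `m₁ + 1`. [cite: BenfattoGiulianiMastropietro2006, §2.8 (2.80)] -/
theorem norm_kernel_crossContract_value_sectorPreimage_le_gram₂_of_b {k e' m m₀ m₁ : ℕ} (he : e' + 1 ≤ k) {β : ℝ} (hβ : 0 ≤ β)
    (F Ft : Fin N → FreqMomentum L M → ℂ)
    {ρ₀ : ℕ} (hρ₀ : ∀ ω : Fin N, ((univ : Finset (Fin N)).filter fun ω' => ∃ q, Ft ω q * Ft ω' q ≠ 0).card ≤ ρ₀)
    (sym : Fin k → FreqMomentum L M × Fin 2 → ℂ) (κ : Fin k → ℝ)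
    (hκF : ∀ (i : Fin k) (Y : SpaceTimeIdx L M × SectorLeg N), Y.2.2 = 0 → ‖sectorGramF L M β Ft (sym i) Y‖ ≤ κ i)
    (hκG : ∀ (i : Fin k) (Y : SpaceTimeIdx L M × SectorLeg N), Y.2.2 = 1 → ‖sectorGramG L M β Ft (sym i) Y‖ ≤ κ i)
    (Ga Gb : HubbardGrassmann L M) (s : Fin m → Fin 2)
    (hm₀ : (univ.filter fun i => s i = 0).card = m₀) (hm₁ : (univ.filter fun i => s i = 1).card = m₁ + 1)
    (Z : Fin m → SpaceTimeIdx L M × SectorLeg N) {α : ℝ} (hα : 0 ≤ α)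
    (hrow : ∀ X, ∑ Y, ‖((sectorSubMatrix L M β Ft).transpose * normalCovariance L M (sym (Fin.castLE he 0)) * sectorSubMatrix L M β Ft) X Y‖ ≤ α)
    (hcol : ∀ Y, ∑ X, ‖((sectorSubMatrix L M β Ft).transpose * normalCovariance L M (sym (Fin.castLE he 0)) * sectorSubMatrix L M β Ft) X Y‖ ≤ α)
    (δ : Fin e' → ℝ) (hδ : ∀ i, 0 ≤ δ i)
    (hent : ∀ (i : Fin e') X Y,
      ‖((sectorSubMatrix L M β Ft).transpose * normalCovariance L M (sym (Fin.castLE he i.succ)) * sectorSubMatrix L M β Ft) X Y‖ ≤ δ i)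
    {Na Nb : ℝ} (hNa0 : 0 ≤ Na)
    (hNa : ∀ (ω₀ : SectorLeg N) (σ' : Fin e' → SectorLeg N) (ω₁ : Fin m₀ → SectorLeg N),
      hubbardSectorKernelNorm L M β F (prescribedTuples univ
        (Fin.append (fun i : Fin k => if h : (i : ℕ) < e' + 1 then some ((Fin.cons ω₀ σ' : Fin (e' + 1) → SectorLeg N) ⟨i, h⟩) else none)
          (fun j => some (ω₁ j)))) Ga ≤ Na)
    (hNb : ∀ σ₁ : Fin (m₁ + 1) → SectorLeg N, hubbardSectorKernelNorm L M β F (prescribedTuples univ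
      (Fin.append (fun _ : Fin k => (none : Option (SectorLeg N))) (fun j => some (σ₁ j)))) Gb ≤ Nb) :
    ‖kernel ℂ (((List.ofFn fun i => grassmannLaplacian ℂ (crossCov ℂ
        ((sectorSubMatrix L M β Ft).transpose * normalCovariance L M (sym i) * sectorSubMatrix L M β Ft))).reverse).prod
        (dblCopy ℂ 0 (sectorPreimage β F Ga) * dblCopy ℂ 1 (sectorPreimage β F Gb))) m (fun i => (Z i, s i))‖ ≤
      (((k + m₀).factorial * (k + (m₁ + 1)).factorial : ℝ) / (m.factorial * (k - (e' + 1)).factorial)) *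
        (∑ i, κ i ^ 2) ^ (k - (e' + 1)) *
        (α * (∏ i, δ i * ((4 * ρ₀ : ℕ) : ℝ)) * (imagTimeWeight β M * Na) * (imagTimeWeight β M * Nb)) :=
  norm_kernel_crossContract_value_pullback_le_gram_of_b he β Ft hρ₀ sym κ hκF hκG (sectorPreimage β F Ga) (sectorPreimage β F Gb) s hm₀ hm₁ Z
    hα hrow hcol δ hδ hent (mul_nonneg (imagTimeWeight_nonneg hβ M) hNa0)
    (fun X₀ σ' Z₀ => (sum_sum_filter_castLE_norm_kernel_sectorPreimage_le hβ F Ga he X₀ σ' Z₀).trans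
      (mul_le_mul_of_nonneg_left (hNa _ _ _) (imagTimeWeight_nonneg hβ M)))
    fun Y₁ => (sum_fixed_norm_kernel_sectorPreimage_le hβ F Gb Y₁).trans
      (mul_le_mul_of_nonneg_left (hNb _) (imagTimeWeight_nonneg hβ M))

end TwoFamilies

end Summit.HubbardSuperconductivity.HubbardSuperconductivity.Theorems.KLRegimeWick

end
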